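import Summits.AtomisticToContinuum.Crystallization.Theorems.ChartedZeroExcessLayeredLatticeLiouvilleZZZYRCG

/-!
# Charted zero-excess layered-lattice Liouville — ZZZYRCZN: the CANONICAL-CLASS ATLAS DOOR (PROVED, pointwise chain)

Cell `decomp-a2c`, lens 2, generation 100; line (D) TAIL-DEBIT of `UniformEquilStabilityAt`; ruling r1860 (B) «C0-LABEL / LABEL-CONVENTION»
(labelling of record := (α) canonical periodic letters; drift labelling OUT; type the restriction ADDITIVELY — tree ZZZYRA / ZZZYRCG stay verbatim).

THE DEFECT.  `AtlasCoversP s Λ c₀ ℓ₀ InBox` (ZZZYRCG) asks EVERY admissible word `(L, w')` to lie in a box; but admissibility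
(`IsAdmissibleWord`, ZZZYRA) is a property of the layered SET plus a labelling-dependent pair (`c₀`-co-Lipschitz sites, `ℓ₀`-steps), and one set
carries many admissible labellings: the drift labelling of fcc (every step `+(g₁+g₂)/3`, letters unbounded), locally shuffled layer orders
(`w' (2k) ↔ w' (2k+1)`, still `ℓ₀ = 3`-stepped and co-Lipschitz), in-plane lattice re-anchorings layer by layer.  None of these lies in a slab box
of the K-file atlas (ZZZYRCZM `SlabBoxW`: letters in `{0,1,2}`, heights `h m ≥ hLo·a > 0`), so `AtlasCoversP` is false for the concrete atlas
although every SET is covered.  The cheap repair «add a catch-all box `¬ canonical`» fails: the per-box obligations (cell / tail / cluster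
certificates) would then be owed on non-canonical words, and transporting them along a re-labelling breaks at the index currency `nnFormZ`.

THE REPAIR (this file, additive).  A CLASS PREDICATE `Can : ℝ → (E3 ≃L[ℝ] E3) → (ℤ → E3) → Prop` (scale-aware) is threaded through the two
places that see the labelling, and nowhere else:
* `UniformReindexPC s Λ c₀ ℓ₀ Can` — (RI♯-C): (RI♯) whose output word is moreover in the class (`Can a L w'`); for the class of record this is
  where the registry content lives (order the layers along the normal; clean ⇒ hollow stacking ⇒ each interface is `±(g₁+g₂)/3 + slip` modulo the
  in-plane lattice; choose the lattice representatives so that the cumulative letters stay in `{0,1,2}` — re-indexing plus ONE cleanliness lemma);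
* `AtlasCoversPC s Λ c₀ ℓ₀ Can InBox` — coverage is owed on admissible words OF THE CLASS only (JSBOX-SOUND / CELLBOX-SOUND proper: the shape
  dials `a, ρ, τ` from NASH-PIN-h and NASH-PIN-r, memo NODE-g99 §2(h));
* ★★ `uniformEquilStabilityAt_of_atlasC` — THE ATLAS DOOR FOR A CLASS (PROVED): same eleven hypotheses as ZZZYRCG's door with (RI♯-C) and
  AtlasCoversPC in place of (RI♯) and AtlasCoversP; the per-box obligation shapes `BoxCellCertificateP` / `BoxTailDebitP` /
  `BoxClusterCertificateDebitP` and the generic items (CS♯) (NC♯) (PF♯) (PF♯-D) (CZ♯) are consumed VERBATIM (no C-variants of any W-Prop).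
  The proof does not pass through the global W-Props of ZZZYRCE (which quantify over all admissible words): it runs the chain POINTWISE at the
  one word (RI♯-C) delivers — `contactKorn_at` (NODE E's cell-certificate ⇒ Korn argument at a word, the body of
  `uniformContactKornW_of_cellCertificateW`), `halfBudget_at` (resummed debit cluster certificate + tail ⇒ `κ₁·N₁ − γT·Z ≤ E/2` at a word, the body
  of `signedShellBudgetP_of_clusterCertificateDebitW`), `coerciveZ_arith` (currency exchange ⇒ `κ₀·Z ≤ E/2`).
* consistency: `Can := ⊤` recovers ZZZYRCG's door (`uniformReindexPC_of_reindexP`, `atlasCoversPC_of_covers`, the closing `example`); both new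
  Props are monotone in the class (prove (RI♯-C) for a fine class, coverage for a coarse one).
* `IsRegisteredWord δ a L w'` — the intended class of record (α): layers ordered along a unit normal `n` of the chart plane (`0 < h m`), letters
  `ℓ m ∈ {0,1,2}`, every step `w'(m+1) − w'(m) = ((ℓ(m+1) − ℓ m)/3)•(gen₁ L + gen₂ L) + r m + h m•n` with in-plane slip `‖r m‖ ≤ δ·a` — the
  registry half of `SlabBoxW` with a letter FUNCTION (periodic `regW wd` is the special case; aperiodic Barlow words are registered too).
Consumer count (r1860 (B)(2)): `IsAdmissibleWord` 13 tree files — untouched; `AtlasCoversP` 1 file (ZZZYRCG) — untouched, generalised here.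
Def + theorem file (3 defs, 10 theorems, 1 example); imports ZZZYRCG only; no instance / notation / option; 0 sorry. [g100]
-/

open scoped BigOperators InnerProductSpace RealInnerProductSpace

namespace Summit.AtomisticToContinuum.Crystallization.Theorems.ChartedZeroExcessLayeredLatticeLiouville

open Summit.AtomisticToContinuum.Crystallization.Theorems.ChartedPlanarOrderRigidityDoor (E3)
open Summit.AtomisticToContinuum.Crystallization.Theorems.ChartedPlanarOrderMesoCut (LayeredHom)
open Summit.AtomisticToContinuum.Crystallization.Theorems.ChartedPlanarOrderDoorLayered (Layered)

variable {ι : Type*}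

/-! ### §1 the class-restricted pieces -/

/-- **(RI♯-C) «UniformReindexPC s Λ c₀ ℓ₀ Can»** — RE-INDEXING INTO THE CLASS: every equilibrium chart's layered set is `Layered (gen₁ L) (gen₂ L) w'`
for an offset sequence `w'` with `c₀`-co-Lipschitz sites, `ℓ₀`-bounded steps AND `Can a L w'`.  For `Can := IsRegisteredWord δ` this is (RI♯) plus
the registry lemma (clean ⇒ hollow stacking) plus the choice of periodic letters; support · ATTACKABLE-S/M.  Why it might fail: only through a
class too fine for the clean window (a `δ` below the physical slip, letters demanded where cleanliness allows a non-hollow interface). [g100] -/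
def UniformReindexPC (s Λ c₀ ℓ₀ : ℝ) (Can : ℝ → (E3 ≃L[ℝ] E3) → (ℤ → E3) → Prop) : Prop :=
  ∀ a : ℝ, 0 < a → ∀ (L : E3 ≃L[ℝ] E3) (w : ℤ → E3), IsEquilChart a s Λ L w →
    ∃ w' : ℤ → E3, Layered (gen₁ L) (gen₂ L) w' = LayeredHom (L : E3 →L[ℝ] E3) w ∧
      IsLayeredCrystal c₀ (gen₁ L) (gen₂ L) w' ∧ (∀ m : ℤ, ‖w' (m + 1) - w' m‖ ≤ ℓ₀) ∧ Can a L w'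

/-- ★ **«AtlasCoversPC s Λ c₀ ℓ₀ Can InBox»** — the atlas covers the admissible words OF THE CLASS: every admissible `(L, w')` at scale `a` with
`Can a L w'` satisfies `InBox i L w'` for some box index `i` (JSBOX-SOUND ∧ CELLBOX-SOUND owed on canonical labellings only). [g100] -/
def AtlasCoversPC (s Λ c₀ ℓ₀ : ℝ) (Can : ℝ → (E3 ≃L[ℝ] E3) → (ℤ → E3) → Prop) (InBox : ι → (E3 ≃L[ℝ] E3) → (ℤ → E3) → Prop) : Prop :=
  ∀ a : ℝ, 0 < a → ∀ (L : E3 ≃L[ℝ] E3) (w' : ℤ → E3), IsAdmissibleWord a s Λ c₀ ℓ₀ L w' → Can a L w' → ∃ i, InBox i L w'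

/-- **«IsRegisteredWord δ a L w'»** — THE CANONICAL LABELLING OF RECORD (α, r1860 (B)(1)): there are letters `ℓ : ℤ → ℤ` with values in `{0,1,2}`, a
unit normal `n` of the chart plane, in-plane slips `r m` (`‖r m‖ ≤ δ·a`, `r m ⊥ n`) and POSITIVE heights `h m` with
`w'(m+1) − w'(m) = ((ℓ(m+1) − ℓ m)/3)•(gen₁ L + gen₂ L) + r m + h m•n` for every `m` (layers ordered along `n`, periodic registry letters, no drift
of the letters — the slips may drift).  `SlabBoxW wd …` (ZZZYRCZM) is the case `ℓ = regW wd` with the shape dials boxed. [g100] -/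
def IsRegisteredWord (δ a : ℝ) (L : E3 ≃L[ℝ] E3) (w' : ℤ → E3) : Prop :=
  ∃ (ℓ : ℤ → ℤ) (n : E3) (r : ℤ → E3) (h : ℤ → ℝ), (∀ m, 0 ≤ ℓ m ∧ ℓ m ≤ 2) ∧ ‖n‖ = 1 ∧ ⟪gen₁ L, n⟫_ℝ = 0 ∧ ⟪gen₂ L, n⟫_ℝ = 0 ∧
    (∀ m, ‖r m‖ ≤ δ * a ∧ ⟪r m, n⟫_ℝ = 0 ∧ 0 < h m) ∧
    ∀ m : ℤ, w' (m + 1) - w' m = ((((ℓ (m + 1) : ℤ) : ℝ) - ((ℓ m : ℤ) : ℝ)) / 3) • (gen₁ L + gen₂ L) + r m + h m • n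

/-- a wider slip tolerance registers the same word. [g100] -/
theorem isRegisteredWord_mono {δ δ' a : ℝ} {L : E3 ≃L[ℝ] E3} {w' : ℤ → E3} (ha : 0 ≤ a) (hδ : δ ≤ δ') (h : IsRegisteredWord δ a L w') :
    IsRegisteredWord δ' a L w' := by
  obtain ⟨ℓ, n, r, hh, hℓ, hn, h1, h2, hr, hstep⟩ := h
  exact ⟨ℓ, n, r, hh, hℓ, hn, h1, h2, fun m => ⟨(hr m).1.trans (mul_le_mul_of_nonneg_right hδ ha), (hr m).2.1, (hr m).2.2⟩, hstep⟩

/-- (RI♯-C) is monotone in the class, and forgets to (RI♯). [g100] -/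
theorem uniformReindexPC_mono {s Λ c₀ ℓ₀ : ℝ} {Can Can' : ℝ → (E3 ≃L[ℝ] E3) → (ℤ → E3) → Prop}
    (hle : ∀ a L w', Can a L w' → Can' a L w') (h : UniformReindexPC s Λ c₀ ℓ₀ Can) : UniformReindexPC s Λ c₀ ℓ₀ Can' := by
  intro a ha L w hLw
  obtain ⟨w', hset, hco, hlip, hcan⟩ := h a ha L w hLw
  exact ⟨w', hset, hco, hlip, hle a L w' hcan⟩

/-- (RI♯-C) ⇒ (RI♯). [g100] -/
theorem uniformReindexP_of_reindexPC {s Λ c₀ ℓ₀ : ℝ} {Can : ℝ → (E3 ≃L[ℝ] E3) → (ℤ → E3) → Prop} (h : UniformReindexPC s Λ c₀ ℓ₀ Can) :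
    UniformReindexP s Λ c₀ ℓ₀ := by
  intro a ha L w hLw
  obtain ⟨w', hset, hco, hlip, -⟩ := h a ha L w hLw
  exact ⟨w', hset, hco, hlip⟩

/-- (RI♯) is (RI♯-C) for the trivial class. [g100] -/
theorem uniformReindexPC_of_reindexP {s Λ c₀ ℓ₀ : ℝ} (h : UniformReindexP s Λ c₀ ℓ₀) : UniformReindexPC s Λ c₀ ℓ₀ fun _ _ _ => True := by
  intro a ha L w hLw
  obtain ⟨w', hset, hco, hlip⟩ := h a ha L w hLw
  exact ⟨w', hset, hco, hlip, trivial⟩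

/-- coverage is antitone in the class; in particular `AtlasCoversP` ⇒ `AtlasCoversPC` for every class. [g100] -/
theorem atlasCoversPC_mono {s Λ c₀ ℓ₀ : ℝ} {Can Can' : ℝ → (E3 ≃L[ℝ] E3) → (ℤ → E3) → Prop} {InBox : ι → (E3 ≃L[ℝ] E3) → (ℤ → E3) → Prop}
    (hle : ∀ a L w', Can' a L w' → Can a L w') (h : AtlasCoversPC s Λ c₀ ℓ₀ Can InBox) : AtlasCoversPC s Λ c₀ ℓ₀ Can' InBox :=
  fun a ha L w' hA hc => h a ha L w' hA (hle a L w' hc)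

/-- `AtlasCoversP` ⇒ `AtlasCoversPC`. [g100] -/
theorem atlasCoversPC_of_covers {s Λ c₀ ℓ₀ : ℝ} {InBox : ι → (E3 ≃L[ℝ] E3) → (ℤ → E3) → Prop} (Can : ℝ → (E3 ≃L[ℝ] E3) → (ℤ → E3) → Prop)
    (h : AtlasCoversP s Λ c₀ ℓ₀ InBox) : AtlasCoversPC s Λ c₀ ℓ₀ Can InBox :=
  fun a ha L w' hA _ => h a ha L w' hA

/-! ### §2 the chain at ONE admissible word -/

/-- NODE E AT A WORD: cell sums (CS♯) + null Lagrangian (NC♯) + ONE multiplier making the cell certificates at constant `cv` non-negative ⇒ the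
two-sided contact Korn inequality `cKv·N₁(φ) ≤ S₁(φ) ≤ N₁(φ)` at that word, for `0 ≤ cKv`, `cKv·cv ≤ 1` (the body of
`uniformContactKornW_of_cellCertificateW`, verbatim, at a point). [g100] -/
theorem contactKorn_at {a s Λ c₀ ℓ₀ r₁ cv cKv : ℝ} {L : E3 ≃L[ℝ] E3} {w' : ℤ → E3} (ha : 0 < a) (hA : IsAdmissibleWord a s Λ c₀ ℓ₀ L w')
    (hcK0 : 0 ≤ cKv) (hc : cKv * cv ≤ 1) (hCS : CellSumP s Λ c₀ ℓ₀ r₁) (hNL : CellNullLagrangianP s Λ c₀ ℓ₀ r₁)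
    (hμ : ∃ μ : ℝ, ∀ φ : Cell 2 → ℤ → E3,
      (∀ t ∈ tetCells r₁ (gen₁ L) (gen₂ L) w', 0 ≤ tetCert cv μ (gen₁ L) (gen₂ L) w' φ t) ∧
        ∀ o ∈ octCells r₁ (gen₁ L) (gen₂ L) w', 0 ≤ octCert cv μ (gen₁ L) (gen₂ L) w' φ o)
    (φ : Cell 2 → ℤ → E3) (hφ : HasFiniteSupport φ) :
    cKv * contactForm r₁ (gen₁ L) (gen₂ L) w' φ ≤ stretchForm 0 r₁ (gen₁ L) (gen₂ L) w' φ ∧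
      stretchForm 0 r₁ (gen₁ L) (gen₂ L) w' φ ≤ contactForm r₁ (gen₁ L) (gen₂ L) w' φ := by
  obtain ⟨fS, fN, fL, gS, gN, gL, eS, eN, eS', eN'⟩ := hCS a ha L w' hA φ hφ
  have e0 := hNL a ha L w' hA φ hφ
  obtain ⟨μ, hμ⟩ := hμ
  obtain ⟨htet, hoct⟩ := hμ φ
  have hS0 : 0 ≤ stretchForm 0 r₁ (gen₁ L) (gen₂ L) w' φ := stretchForm_nonneg _ _ _ _ _ _
  have h1 : 0 ≤ ∑ᶠ t : tetCells r₁ (gen₁ L) (gen₂ L) w', tetCert cv μ (gen₁ L) (gen₂ L) w' φ t :=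
    finsum_nonneg fun t => htet t.1 t.2
  have h2 : 0 ≤ ∑ᶠ o : octCells r₁ (gen₁ L) (gen₂ L) w', octCert cv μ (gen₁ L) (gen₂ L) w' φ o :=
    finsum_nonneg fun o => hoct o.1 o.2
  have e1 : ∑ᶠ t : tetCells r₁ (gen₁ L) (gen₂ L) w', tetCert cv μ (gen₁ L) (gen₂ L) w' φ t =
      (cv * (24 * stretchForm 0 r₁ (gen₁ L) (gen₂ L) w' φ) - 24 * contactForm r₁ (gen₁ L) (gen₂ L) w' φ) / 6 -
        μ * ∑ᶠ t : tetCells r₁ (gen₁ L) (gen₂ L) w', tetNL (gen₁ L) (gen₂ L) w' φ t := by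
    rw [← eS, ← eN]; exact finsum_cert_expand fS fN fL cv μ 6
  have e2 : ∑ᶠ o : octCells r₁ (gen₁ L) (gen₂ L) w', octCert cv μ (gen₁ L) (gen₂ L) w' φ o =
      (cv * (48 * stretchForm 0 r₁ (gen₁ L) (gen₂ L) w' φ) - 48 * contactForm r₁ (gen₁ L) (gen₂ L) w' φ) / 3 -
        μ * ∑ᶠ o : octCells r₁ (gen₁ L) (gen₂ L) w', octNLw (gen₁ L) (gen₂ L) w' φ o := by
    rw [← eS', ← eN']; exact finsum_cert_expand gS gN gL cv μ 3
  refine ⟨cell_arith h1 h2 e1 e2 e0 hS0 hcK0 hc, ?_⟩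
  have hle : ∑ᶠ t : tetCells r₁ (gen₁ L) (gen₂ L) w', tetS (gen₁ L) (gen₂ L) w' φ t ≤ ∑ᶠ t : tetCells r₁ (gen₁ L) (gen₂ L) w', tetN φ t :=
    finsum_le_finsum' fS fN fun t => tetS_le_tetN _ _ _ _ _
  rw [eS, eN] at hle
  linarith [hle]

/-- THE DEBIT CERTIFICATE AT A WORD: resummation (PF♯) / (PF♯-D) of ONE debit cluster certificate (closure `2κ₁ ≤ μ·cKv − ν`), the null
Lagrangian (NL♯, PROVED `nullLagrangianP`), the tail-debit bound at `(φ, E)` and the Korn lower half at `cKv` ⇒ `κ₁·N₁(φ) − γT·nnFormZ φ ≤ E/2`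
(the body of `signedShellBudgetP_of_clusterCertificateDebitW` at a point, closed by `certificateFull_arith`). [g100] -/
theorem halfBudget_at {a s Λ c₀ ℓ₀ r₁ ϱ R κ₁ γT cKv E : ℝ} {L : E3 ≃L[ℝ] E3} {w' : ℤ → E3}
    {ΘRv ΘNv : (Cell 2 × ℤ) × (Cell 2 × ℤ) → ℝ} (ha : 0 < a) (hA : IsAdmissibleWord a s Λ c₀ ℓ₀ L w')
    (hPU : PartitionIdentityFullP s Λ c₀ ℓ₀ r₁ ϱ R) (hPD : PartitionIdentityDebitP s Λ c₀ ℓ₀ ϱ R)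
    (hJ : ∃ (μ ν : ℝ) (d : ℤ → Cell 2) (Cpar : ℤ → Fin 3 → Fin 3 → (E3 →L[ℝ] E3)) (Cperp : Fin 3 → Fin 3 → (E3 →L[ℝ] E3)),
      0 ≤ μ ∧ IsShortStep r₁ (gen₁ L) (gen₂ L) w' d ∧ 2 * κ₁ ≤ μ * cKv - ν ∧
      ∀ (c : Cell 2 × ℤ) (φ : Cell 2 → ℤ → E3), HasFiniteSupport φ →
        clusterDebit ϱ R ΘRv ΘNv (gen₁ L) (gen₂ L) w' c φ ≤ clusterFormFull r₁ ϱ R μ ν d Cpar Cperp (gen₁ L) (gen₂ L) w' c φ)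
    (φ : Cell 2 → ℤ → E3) (hφ : HasFiniteSupport φ)
    (h1 : rangeHessSum ϱ (gen₁ L) (gen₂ L) w' φ - debitForm ϱ ΘRv ΘNv (gen₁ L) (gen₂ L) w' φ - 2 * γT * nnFormZ φ ≤ E)
    (hK1 : cKv * contactForm r₁ (gen₁ L) (gen₂ L) w' φ ≤ stretchForm 0 r₁ (gen₁ L) (gen₂ L) w' φ) :
    κ₁ * contactForm r₁ (gen₁ L) (gen₂ L) w' φ - γT * nnFormZ φ ≤ E / 2 := by
  obtain ⟨μ, ν, d, Cpar, Cperp, hμ, hd, hc, hcl⟩ := hJ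
  have h2 := hPU a ha L w' hA φ hφ μ ν d Cpar Cperp hd
  have h3 := hPD a ha L w' hA φ hφ ΘRv ΘNv
  have h0 : nullTotal d Cpar Cperp φ = 0 := nullLagrangianP d Cpar Cperp φ hφ
  have hcert' : 0 ≤ rangeHessSum ϱ (gen₁ L) (gen₂ L) w' φ
      - μ * stretchForm 0 r₁ (gen₁ L) (gen₂ L) w' φ + ν * contactForm r₁ (gen₁ L) (gen₂ L) w' φ + nullTotal d Cpar Cperp φ
      - debitForm ϱ ΘRv ΘNv (gen₁ L) (gen₂ L) w' φ :=
    HasSum.nonneg (fun c => sub_nonneg.mpr (hcl c φ hφ)) (h2.sub h3)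
  have hcert : 0 ≤ (rangeHessSum ϱ (gen₁ L) (gen₂ L) w' φ - debitForm ϱ ΘRv ΘNv (gen₁ L) (gen₂ L) w' φ)
      - μ * stretchForm 0 r₁ (gen₁ L) (gen₂ L) w' φ + ν * contactForm r₁ (gen₁ L) (gen₂ L) w' φ := by linarith
  have h1' : (rangeHessSum ϱ (gen₁ L) (gen₂ L) w' φ - debitForm ϱ ΘRv ΘNv (gen₁ L) (gen₂ L) w' φ)
      - 2 * 0 * contactForm r₁ (gen₁ L) (gen₂ L) w' φ - 2 * γT * nnFormZ φ ≤ E := by linarith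
  have hc' : 2 * (κ₁ + 0) ≤ μ * cKv - ν := by linarith
  have hN : 0 ≤ contactForm r₁ (gen₁ L) (gen₂ L) w' φ := contactForm_nonneg _ _ _ _ _
  exact certificateFull_arith h1' hcert hK1 hN hμ hc'

/-- THE CLOSING ARITHMETIC: `κ₁·N₁ − γT·Z ≤ E/2`, currency exchange `cZ·Z ≤ N₁`, `0 ≤ Z`, `0 ≤ κ₁`, `κ₀ ≤ κ₁·cZ − γT` ⇒ `κ₀·Z ≤ E/2`. [g100] -/
theorem coerciveZ_arith {κ₀ κ₁ cZ γT N₁ Z E : ℝ} (hmain : κ₁ * N₁ - γT * Z ≤ E / 2) (hZ : cZ * Z ≤ N₁) (hZ0 : 0 ≤ Z) (h0 : 0 ≤ κ₁)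
    (hκ : κ₀ ≤ κ₁ * cZ - γT) : κ₀ * Z ≤ E / 2 := by
  have h3 : κ₁ * (cZ * Z) ≤ κ₁ * N₁ := mul_le_mul_of_nonneg_left hZ h0
  have h4 : κ₀ * Z ≤ (κ₁ * cZ - γT) * Z := mul_le_mul_of_nonneg_right hκ hZ0
  have h5 : (κ₁ * cZ - γT) * Z = κ₁ * (cZ * Z) - γT * Z := by ring
  linarith [h3, h4, h5]

/-! ### §3 the door -/

/-- ★★ **THE ATLAS DOOR FOR A CLASS (PROVED): (RI♯-C Can) ∧ (CS♯) ∧ (NC♯) ∧ AtlasCoversPC Can ∧ (∀ i, BoxCell (c i)) ∧ (∀ i, BoxTail) ∧ (PF♯) ∧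
(PF♯-D) ∧ (∀ i, BoxCluster (cK i)) ∧ (CZ♯) ⇒ (U♯) `UniformEquilStabilityAt s Λ κ₀ c₀`**, for box constants `0 ≤ cK i`, `cK i · c i ≤ 1`, `0 ≤ κ₁`,
`κ₀ ≤ κ₁·cZ − γT` — ZZZYRCG's `uniformEquilStabilityAt_of_atlas` with re-indexing INTO and coverage OF an arbitrary class `Can`.  Proof: re-index the
equilibrium chart into the class, pick the box of that one word, and run §2 at it (no selector, no global W-Prop). [g100] -/
theorem uniformEquilStabilityAt_of_atlasC {s Λ c₀ ℓ₀ r₁ ϱ R cZ κ₁ κ₀ γT : ℝ} {Can : ℝ → (E3 ≃L[ℝ] E3) → (ℤ → E3) → Prop}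
    {InBox : ι → (E3 ≃L[ℝ] E3) → (ℤ → E3) → Prop} {c cK : ι → ℝ} {ΘR ΘN : ι → (E3 ≃L[ℝ] E3) → (ℤ → E3) → (Cell 2 × ℤ) × (Cell 2 × ℤ) → ℝ}
    (h0 : 0 ≤ κ₁) (hκ : κ₀ ≤ κ₁ * cZ - γT) (hRI : UniformReindexPC s Λ c₀ ℓ₀ Can)
    (hcK0 : ∀ i, 0 ≤ cK i) (hcK : ∀ i, cK i * c i ≤ 1)
    (hCS : CellSumP s Λ c₀ ℓ₀ r₁) (hNC : CellNullLagrangianP s Λ c₀ ℓ₀ r₁) (hcov : AtlasCoversPC s Λ c₀ ℓ₀ Can InBox)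
    (hcell : ∀ i, BoxCellCertificateP s Λ c₀ ℓ₀ r₁ (InBox i) (c i)) (htail : ∀ i, BoxTailDebitP s Λ c₀ ℓ₀ ϱ (InBox i) (ΘR i) (ΘN i) γT)
    (hPU : PartitionIdentityFullP s Λ c₀ ℓ₀ r₁ ϱ R) (hPD : PartitionIdentityDebitP s Λ c₀ ℓ₀ ϱ R)
    (hclus : ∀ i, BoxClusterCertificateDebitP s Λ c₀ ℓ₀ r₁ ϱ R (InBox i) (cK i) (ΘR i) (ΘN i) κ₁) (hCZ : IndexCurrencyP s Λ c₀ ℓ₀ r₁ cZ) :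
    UniformEquilStabilityAt s Λ κ₀ c₀ := by
  intro a ha L w hLw
  obtain ⟨w', hset, hco, hlip, hcan⟩ := hRI a ha L w hLw
  have hadm : IsAdmissibleWord a s Λ c₀ ℓ₀ L w' := isAdmissibleWord_of_equilChart hLw hset hco hlip
  obtain ⟨i, hBi⟩ := hcov a ha L w' hadm hcan
  refine ⟨w', hset, hco, ?_⟩
  intro φ hφ E hE
  obtain ⟨hK1, -⟩ := contactKorn_at ha hadm (hcK0 i) (hcK i) hCS hNC (hcell i a ha L w' hadm hBi) φ hφ
  have hmain := halfBudget_at ha hadm hPU hPD (hclus i a ha L w' hadm hBi) φ hφ (htail i a ha L w' hadm hBi φ hφ E hE) hK1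
  have hZ0 : 0 ≤ nnFormZ φ := finsum_nonneg fun x => by
    split_ifs <;> positivity
  exact coerciveZ_arith hmain (hCZ a ha L w' hadm φ hφ) hZ0 h0 hκ

/-- CONSISTENCY: ZZZYRCG's door is the trivial-class case (same hypotheses, conclusion by `uniformEquilStabilityAt_of_atlasC`). [g100] -/
example {s Λ c₀ ℓ₀ r₁ ϱ R cZ κ₁ κ₀ γT : ℝ} {InBox : ι → (E3 ≃L[ℝ] E3) → (ℤ → E3) → Prop}
    {c cK : ι → ℝ} {ΘR ΘN : ι → (E3 ≃L[ℝ] E3) → (ℤ → E3) → (Cell 2 × ℤ) × (Cell 2 × ℤ) → ℝ}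
    (h0 : 0 ≤ κ₁) (hκ : κ₀ ≤ κ₁ * cZ - γT) (hRI : UniformReindexP s Λ c₀ ℓ₀)
    (hcK0 : ∀ i, 0 ≤ cK i) (hcK : ∀ i, cK i * c i ≤ 1)
    (hCS : CellSumP s Λ c₀ ℓ₀ r₁) (hNC : CellNullLagrangianP s Λ c₀ ℓ₀ r₁) (hcov : AtlasCoversP s Λ c₀ ℓ₀ InBox)
    (hcell : ∀ i, BoxCellCertificateP s Λ c₀ ℓ₀ r₁ (InBox i) (c i)) (htail : ∀ i, BoxTailDebitP s Λ c₀ ℓ₀ ϱ (InBox i) (ΘR i) (ΘN i) γT)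
    (hPU : PartitionIdentityFullP s Λ c₀ ℓ₀ r₁ ϱ R) (hPD : PartitionIdentityDebitP s Λ c₀ ℓ₀ ϱ R)
    (hclus : ∀ i, BoxClusterCertificateDebitP s Λ c₀ ℓ₀ r₁ ϱ R (InBox i) (cK i) (ΘR i) (ΘN i) κ₁) (hCZ : IndexCurrencyP s Λ c₀ ℓ₀ r₁ cZ) :
    UniformEquilStabilityAt s Λ κ₀ c₀ :=
  uniformEquilStabilityAt_of_atlasC h0 hκ (uniformReindexPC_of_reindexP hRI) hcK0 hcK hCS hNC (atlasCoversPC_of_covers _ hcov) hcell htail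
    hPU hPD hclus hCZ

end Summit.AtomisticToContinuum.Crystallization.Theorems.ChartedZeroExcessLayeredLatticeLiouville
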